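import Mathlib
import HarnessLib
import Summits.HubbardSuperconductivity.HubbardSuperconductivity.Theorems.KLProgrammeKLRegimeEnginePairTransferDLineTwoShellCrossed

/-!
# Route `KLProgramme` — ENGINE child gen 8 (stmt-HubbardSuperconductivity-20437 `KLRegimeEngineV17F2`), skeleton v2 class #5 rev 3: the FLAT (sign-blind) bounds of
# the weight masses of `klmd_defect_le_masses_family` / `klmd_defectDiff_le_masses_family` — every direct / crossed / born mass against the slice line is at most
# `c·(βL²)²/Λ(t)² × Σ_p |φ(p)|·‖ĝ_K(p)‖ = c·(βL²)³·(Λₙ/Λ(t)²)·klSoftMass n φ`, for ANY weight `φ`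
# (cell gate-hubbard-kl, seat hubbard-kl-k3c2-p2 g16; KLTC-INDEX v10.3 §D rows «k3c2-p2»; companion of `…DLineTwoShell(Crossed)`)

WHY.  Rows 40/41 of KLTC-INDEX v10 take NINE weight masses as hypotheses (`Wd Wx W6` of members `j`, `j′`, `WD₁ WD₂ WD₃` of the `D`-line).  For the deep
`D`-line the two-shell files give the geometric gain; for the MEMBER masses (running symbol `Φ_i = s_{n+1,i} + (w_{Λₙ₊₁} − w_{Λ(t)})`, which equals `1 − w_{Λ(t)}` on the
slice band) no geometric gain exists in sign-blind form (located reading «(X).3-MASSES-SIGNBLIND», HOME/STATUS 09:46Z) — but the consumer still needs NAMED bounds.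
Here they are, for an ARBITRARY weight `φ : FreqMomentum → ℝ` (so they serve `Φ_j`, `Φ_{j′}` and `D` alike), using only the slice factor
`|ẇ_{Λ(t)}|·‖ĝ_K‖ ≤ 128/(3Λ(t)²)` (`slice_factor_le`) and the collapse of the partner sums (`sum_partner_ite_eq`, `card_partner_le_one`, `card_source_le_one`):
* **`direct_mass_le_softSum`** — `Σ_p Σ_σ Σ_{p′} 𝟙[direct] ‖(φ·βĝ)(ẇ·βĝ)′ + (ẇ·βĝ)(φ·βĝ)′‖ ≤ (512/3)·(βL²)²/Λ(t)²·Σ_p |φ(p)|‖ĝ_K(p)‖`;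
* **`crossed_mass_le_softSum`** — the crossed mass `≤ (256/3)·(βL²)²/Λ(t)²·Σ_p |φ(p)|‖ĝ_K(p)‖`;
* **`born_mass_le_softSum`** — the born mass `≤ (256/3)·(βL²)²/Λ(t)²·Σ_p |φ(p)|‖ĝ_K(p)‖`;
* `softSum_eq_klSoftMass` — `Σ_p |φ(p)|‖ĝ_K(p)‖ = Λₙ·βL²·klSoftMass n φ` (so `(Λₙ−Λₙ₊₁)(βL²)⁻³·M4²·W ≤ c′·M4²·klSoftMass n φ`, `Λₙ/Λ(t) ≤ 4`).
* §3 (append) the same three in the door's normalisation at `Λ = Λ(t)`: **`direct_row_flat_le`** (`≤ 2048·klSoftMass n φ`), **`crossed_row_flat_le`**,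
  **`born_row_flat_le`** (`≤ 1024·klSoftMass n φ`) — e.g. `≤ 2048·klIdxMass n j′` for the `D`-line (`klSoftMass_compl_sub_compl_le_klIdxMass`), `≤ 2048·15367` for a member.
Plumbing; `0 < Λ(t)` is the only hypothesis on the scale; nothing about the model's sizes is asserted; nothing asserts (X).3, (c), K3 or superconductivity.  0 kit · 0 lit.
-/

noncomputable section

namespace Summit.HubbardSuperconductivity.HubbardSuperconductivity.Theorems.KLRegimeSplit

set_option linter.dupNamespace false -- summit = problem name (single-conjunct summit), D-0017

open Real Finset Set Literature.MathematicalPhysics.QuantumLattice Literature.Probability.LatticeModels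
open Literature.MathematicalPhysics.QuantumLattice.FermiRG
open Summit.HubbardSuperconductivity.HubbardSuperconductivity.Theorems.KLProgrammeLegKernels
open Summit.HubbardSuperconductivity.HubbardSuperconductivity.Theorems.TwoPointAssembly
open Summit.HubbardSuperconductivity.HubbardSuperconductivity.Theorems.DispersionFlow
open Summit.HubbardSuperconductivity.HubbardSuperconductivity.Theorems.KLRegimeWick
open Summit.HubbardSuperconductivity.HubbardSuperconductivity.Theorems.EngineV8

variable {L M : ℕ} (β μ : ℝ) (K : TrigPolyC4v)

/-! ## §1 One product: `|φ(p)|βL²‖ĝ(p)‖ · |ẇ_Λ(p′)|βL²‖ĝ(p′)‖ ≤ (βL²)²·(128/(3Λ²))·|φ(p)|‖ĝ(p)‖` -/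

/-- One product against the slice factor (any weight, any partner). -/
theorem weightProd_le_slice [NeZero L] {β : ℝ} (hβ : 0 < β) (μ : ℝ) (K : TrigPolyC4v) {Λ : ℝ} (hΛ : 0 < Λ) (a : ℝ) (p p' : FreqMomentum L M) :
    |a| * ((β * (L : ℝ) ^ 2) * ‖propCT L M β μ K p‖) *
        (|deriv (fun Λ' : ℝ => hubbardCutoffWeightCT L M β μ K Λ' p') Λ| * ((β * (L : ℝ) ^ 2) * ‖propCT L M β μ K p'‖)) ≤
      (β * (L : ℝ) ^ 2) ^ 2 * (128 / (3 * Λ ^ 2)) * (|a| * ‖propCT L M β μ K p‖) := by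
  have hβL : 0 < β * (L : ℝ) ^ 2 := by
    have : (0 : ℝ) < L := by exact_mod_cast Nat.pos_of_ne_zero (NeZero.ne L)
    positivity
  have h2 := slice_factor_le β μ K hΛ p'
  have ha : 0 ≤ |a| * ‖propCT L M β μ K p‖ := by positivity
  calc _ = (|deriv (fun Λ' : ℝ => hubbardCutoffWeightCT L M β μ K Λ' p') Λ| * ‖propCT L M β μ K p'‖) * ((β * (L : ℝ) ^ 2) ^ 2 * (|a| * ‖propCT L M β μ K p‖)) := by
        ring
    _ ≤ 128 / (3 * Λ ^ 2) * ((β * (L : ℝ) ^ 2) ^ 2 * (|a| * ‖propCT L M β μ K p‖)) := mul_le_mul_of_nonneg_right h2 (by positivity)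
    _ = _ := by ring

/-- The soft sum is shift invariant: `Σ_p |φ(p⁺)|‖ĝ(p⁺)‖ = Σ_p |φ(p)|‖ĝ(p)‖`, `p⁺ = (ω_p, k_p + q)`. -/
theorem softSum_shift [NeZero L] (φ : FreqMomentum L M → ℝ) (q : TorusSite 2 L) :
    ∑ p : FreqMomentum L M, |φ (p.1, p.2 + q)| * ‖propCT L M β μ K (p.1, p.2 + q)‖ = ∑ p : FreqMomentum L M, |φ p| * ‖propCT L M β μ K p‖ := by
  set e : FreqMomentum L M ≃ FreqMomentum L M := Equiv.prodCongr (Equiv.refl _) (Equiv.addRight q) with hedef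
  have h := Equiv.sum_comp e (fun p : FreqMomentum L M => |φ p| * ‖propCT L M β μ K p‖)
  have e1 : ∀ p : FreqMomentum L M, e p = (p.1, p.2 + q) := fun p => rfl
  simp only [e1] at h
  exact h

/-- **`Σ_p |φ(p)|‖ĝ_K(p)‖ = Λₙ·βL²·klSoftMass n φ`** (`0 < β`). -/
theorem softSum_eq_klSoftMass [NeZero L] {β : ℝ} (hβ : 0 < β) (μ : ℝ) (K : TrigPolyC4v) (n : ℕ) (φ : FreqMomentum L M → ℝ) :
    ∑ p : FreqMomentum L M, |φ p| * ‖propCT L M β μ K p‖ = klScale klE0 n * (β * (L : ℝ) ^ 2) * klSoftMass L M β μ K n φ := by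
  unfold klSoftMass
  have hΛ := klth_klScale_pos n
  have hβL : 0 < β * (L : ℝ) ^ 2 := by
    have : (0 : ℝ) < L := by exact_mod_cast Nat.pos_of_ne_zero (NeZero.ne L)
    positivity
  rw [← mul_assoc, mul_inv_cancel₀ (by positivity), one_mul]

/-! ## §2 The three flat bounds -/

/-- **The DIRECT mass, flat bound** (any weight `φ`, `0 < Λ`):
`Σ_p Σ_σ Σ_{p′} 𝟙[m_{p′} = m_p ∧ k′ = k + x − y]·‖(φ(p)βĝ(p))(ẇ_Λ(p′)βĝ(p′)) + (ẇ_Λ(p)βĝ(p))(φ(p′)βĝ(p′))‖ ≤ (512/3)·(βL²)²/Λ²·Σ_p |φ(p)|‖ĝ_K(p)‖`. -/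
theorem direct_mass_le_softSum [NeZero L] [NeZero M] (hβ : 0 < β) {Λ : ℝ} (hΛ : 0 < Λ) (φ : FreqMomentum L M → ℝ) (x y : TorusSite 2 L) :
    ∑ p : FreqMomentum L M, ∑ _σ : Fin 2, ∑ p' : FreqMomentum L M,
      (if matsubaraInt M p'.1 + matsubaraInt M (omega0 M) = matsubaraInt M p.1 + matsubaraInt M (omega0 M) ∧ p'.2 = p.2 + x - y then
        ‖(((φ p : ℝ) : ℂ) * (((β * (L : ℝ) ^ 2 : ℝ) : ℂ) * propCT L M β μ K p)) *
            ((((deriv (fun Λ' : ℝ => hubbardCutoffWeightCT L M β μ K Λ' p') Λ : ℝ)) : ℂ) * (((β * (L : ℝ) ^ 2 : ℝ) : ℂ) * propCT L M β μ K p')) +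
          ((((deriv (fun Λ' : ℝ => hubbardCutoffWeightCT L M β μ K Λ' p) Λ : ℝ)) : ℂ) * (((β * (L : ℝ) ^ 2 : ℝ) : ℂ) * propCT L M β μ K p)) *
            (((φ p' : ℝ) : ℂ) * (((β * (L : ℝ) ^ 2 : ℝ) : ℂ) * propCT L M β μ K p'))‖
      else 0) ≤
      512 / 3 * (β * (L : ℝ) ^ 2) ^ 2 / Λ ^ 2 * ∑ p : FreqMomentum L M, |φ p| * ‖propCT L M β μ K p‖ := by
  classical
  set q : TorusSite 2 L := x - y with hq
  set Wd : FreqMomentum L M → ℝ := fun p => deriv (fun Λ' : ℝ => hubbardCutoffWeightCT L M β μ K Λ' p) Λ with hWddef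
  set C0 : ℝ := (β * (L : ℝ) ^ 2) ^ 2 * (128 / (3 * Λ ^ 2)) with hC0
  have hcollapse : ∀ p : FreqMomentum L M,
      (∑ _σ : Fin 2, ∑ p' : FreqMomentum L M,
        (if matsubaraInt M p'.1 + matsubaraInt M (omega0 M) = matsubaraInt M p.1 + matsubaraInt M (omega0 M) ∧ p'.2 = p.2 + x - y then
          ‖(((φ p : ℝ) : ℂ) * (((β * (L : ℝ) ^ 2 : ℝ) : ℂ) * propCT L M β μ K p)) * (((Wd p' : ℝ) : ℂ) * (((β * (L : ℝ) ^ 2 : ℝ) : ℂ) * propCT L M β μ K p')) +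
            (((Wd p : ℝ) : ℂ) * (((β * (L : ℝ) ^ 2 : ℝ) : ℂ) * propCT L M β μ K p)) * (((φ p' : ℝ) : ℂ) * (((β * (L : ℝ) ^ 2 : ℝ) : ℂ) * propCT L M β μ K p'))‖
        else 0)) =
      2 * ‖(((φ p : ℝ) : ℂ) * (((β * (L : ℝ) ^ 2 : ℝ) : ℂ) * propCT L M β μ K p)) *
            (((Wd (p.1, p.2 + q) : ℝ) : ℂ) * (((β * (L : ℝ) ^ 2 : ℝ) : ℂ) * propCT L M β μ K (p.1, p.2 + q))) +
          (((Wd p : ℝ) : ℂ) * (((β * (L : ℝ) ^ 2 : ℝ) : ℂ) * propCT L M β μ K p)) *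
            (((φ (p.1, p.2 + q) : ℝ) : ℂ) * (((β * (L : ℝ) ^ 2 : ℝ) : ℂ) * propCT L M β μ K (p.1, p.2 + q)))‖ := by
    intro p
    rw [sum_partner_ite_eq x y p, Finset.sum_const, Finset.card_univ, Fintype.card_fin, nsmul_eq_mul]
    have e : p.2 + x - y = p.2 + q := by rw [hq]; abel
    rw [e]
    norm_num
  have hT : ∀ p : FreqMomentum L M,
      ‖(((φ p : ℝ) : ℂ) * (((β * (L : ℝ) ^ 2 : ℝ) : ℂ) * propCT L M β μ K p)) *
            (((Wd (p.1, p.2 + q) : ℝ) : ℂ) * (((β * (L : ℝ) ^ 2 : ℝ) : ℂ) * propCT L M β μ K (p.1, p.2 + q))) +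
          (((Wd p : ℝ) : ℂ) * (((β * (L : ℝ) ^ 2 : ℝ) : ℂ) * propCT L M β μ K p)) *
            (((φ (p.1, p.2 + q) : ℝ) : ℂ) * (((β * (L : ℝ) ^ 2 : ℝ) : ℂ) * propCT L M β μ K (p.1, p.2 + q)))‖ ≤
      C0 * (|φ p| * ‖propCT L M β μ K p‖) + C0 * (|φ (p.1, p.2 + q)| * ‖propCT L M β μ K (p.1, p.2 + q)‖) := by
    intro p
    refine (norm_add_le _ _).trans (add_le_add ?_ ?_)
    · rw [norm_weightProd_eq hβ]
      exact weightProd_le_slice hβ μ K hΛ (φ p) p (p.1, p.2 + q)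
    · rw [norm_weightProd_eq hβ]
      calc |Wd p| * ((β * (L : ℝ) ^ 2) * ‖propCT L M β μ K p‖) * (|φ (p.1, p.2 + q)| * ((β * (L : ℝ) ^ 2) * ‖propCT L M β μ K (p.1, p.2 + q)‖))
          = |φ (p.1, p.2 + q)| * ((β * (L : ℝ) ^ 2) * ‖propCT L M β μ K (p.1, p.2 + q)‖) * (|Wd p| * ((β * (L : ℝ) ^ 2) * ‖propCT L M β μ K p‖)) := by ring
        _ ≤ _ := weightProd_le_slice hβ μ K hΛ (φ (p.1, p.2 + q)) (p.1, p.2 + q) p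
  calc _ = ∑ p : FreqMomentum L M, 2 * ‖(((φ p : ℝ) : ℂ) * (((β * (L : ℝ) ^ 2 : ℝ) : ℂ) * propCT L M β μ K p)) *
            (((Wd (p.1, p.2 + q) : ℝ) : ℂ) * (((β * (L : ℝ) ^ 2 : ℝ) : ℂ) * propCT L M β μ K (p.1, p.2 + q))) +
          (((Wd p : ℝ) : ℂ) * (((β * (L : ℝ) ^ 2 : ℝ) : ℂ) * propCT L M β μ K p)) *
            (((φ (p.1, p.2 + q) : ℝ) : ℂ) * (((β * (L : ℝ) ^ 2 : ℝ) : ℂ) * propCT L M β μ K (p.1, p.2 + q)))‖ := Finset.sum_congr rfl fun p _ => hcollapse p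
    _ ≤ ∑ p : FreqMomentum L M, 2 * (C0 * (|φ p| * ‖propCT L M β μ K p‖) + C0 * (|φ (p.1, p.2 + q)| * ‖propCT L M β μ K (p.1, p.2 + q)‖)) :=
        Finset.sum_le_sum fun p _ => mul_le_mul_of_nonneg_left (hT p) (by norm_num)
    _ = 2 * C0 * (∑ p : FreqMomentum L M, |φ p| * ‖propCT L M β μ K p‖ + ∑ p : FreqMomentum L M, |φ (p.1, p.2 + q)| * ‖propCT L M β μ K (p.1, p.2 + q)‖) := by
        rw [← Finset.sum_add_distrib, Finset.mul_sum]
        exact Finset.sum_congr rfl fun p _ => by ring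
    _ = 512 / 3 * (β * (L : ℝ) ^ 2) ^ 2 / Λ ^ 2 * ∑ p : FreqMomentum L M, |φ p| * ‖propCT L M β μ K p‖ := by
        rw [softSum_shift β μ K φ q, hC0]; field_simp; ring

/-- **The CROSSED mass, flat bound** (any weight `φ`, `0 < Λ`):
`Σ_p Σ_{p′} 𝟙[m_{p′} + 1 = m_p ∧ k′ = k + Q_m − x − y]·‖…‖ ≤ (256/3)·(βL²)²/Λ²·Σ_p |φ(p)|‖ĝ_K(p)‖`. -/
theorem crossed_mass_le_softSum [NeZero L] [NeZero M] (hβ : 0 < β) {Λ : ℝ} (hΛ : 0 < Λ) (φ : FreqMomentum L M → ℝ) (Qm x y : TorusSite 2 L) :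
    ∑ p : FreqMomentum L M, ∑ p' : FreqMomentum L M,
      (if matsubaraInt M p'.1 + matsubaraInt M (omega0 M) + matsubaraInt M (omega0 M) + 1 = matsubaraInt M p.1 ∧ p'.2 = p.2 + Qm - x - y then
        ‖(((φ p : ℝ) : ℂ) * (((β * (L : ℝ) ^ 2 : ℝ) : ℂ) * propCT L M β μ K p)) *
            ((((deriv (fun Λ' : ℝ => hubbardCutoffWeightCT L M β μ K Λ' p') Λ : ℝ)) : ℂ) * (((β * (L : ℝ) ^ 2 : ℝ) : ℂ) * propCT L M β μ K p')) +
          ((((deriv (fun Λ' : ℝ => hubbardCutoffWeightCT L M β μ K Λ' p) Λ : ℝ)) : ℂ) * (((β * (L : ℝ) ^ 2 : ℝ) : ℂ) * propCT L M β μ K p)) *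
            (((φ p' : ℝ) : ℂ) * (((β * (L : ℝ) ^ 2 : ℝ) : ℂ) * propCT L M β μ K p'))‖
      else 0) ≤
      256 / 3 * (β * (L : ℝ) ^ 2) ^ 2 / Λ ^ 2 * ∑ p : FreqMomentum L M, |φ p| * ‖propCT L M β μ K p‖ := by
  classical
  set Wd : FreqMomentum L M → ℝ := fun p => deriv (fun Λ' : ℝ => hubbardCutoffWeightCT L M β μ K Λ' p) Λ with hWddef
  set c : FreqMomentum L M → FreqMomentum L M → Prop := fun p p' =>
    matsubaraInt M p'.1 + matsubaraInt M (omega0 M) + matsubaraInt M (omega0 M) + 1 = matsubaraInt M p.1 ∧ p'.2 = p.2 + Qm - x - y with hc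
  set C0 : ℝ := (β * (L : ℝ) ^ 2) ^ 2 * (128 / (3 * Λ ^ 2)) with hC0
  have hC00 : 0 ≤ C0 := by positivity
  have hsplit : ∀ p p' : FreqMomentum L M,
      (if c p p' then ‖(((φ p : ℝ) : ℂ) * (((β * (L : ℝ) ^ 2 : ℝ) : ℂ) * propCT L M β μ K p)) * (((Wd p' : ℝ) : ℂ) * (((β * (L : ℝ) ^ 2 : ℝ) : ℂ) * propCT L M β μ K p')) +
          (((Wd p : ℝ) : ℂ) * (((β * (L : ℝ) ^ 2 : ℝ) : ℂ) * propCT L M β μ K p)) * (((φ p' : ℝ) : ℂ) * (((β * (L : ℝ) ^ 2 : ℝ) : ℂ) * propCT L M β μ K p'))‖ else 0) ≤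
      (if c p p' then |φ p| * ((β * (L : ℝ) ^ 2) * ‖propCT L M β μ K p‖) * (|Wd p'| * ((β * (L : ℝ) ^ 2) * ‖propCT L M β μ K p'‖)) else 0) +
      (if c p p' then |φ p'| * ((β * (L : ℝ) ^ 2) * ‖propCT L M β μ K p'‖) * (|Wd p| * ((β * (L : ℝ) ^ 2) * ‖propCT L M β μ K p‖)) else 0) := by
    intro p p'
    split_ifs with hcc
    · refine (norm_add_le _ _).trans (add_le_add (le_of_eq (norm_weightProd_eq hβ μ K _ _ p p')) (le_of_eq ?_))
      rw [norm_weightProd_eq hβ μ K]; ring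
    · simp
  have hA' : ∀ p : FreqMomentum L M,
      (∑ p' : FreqMomentum L M, if c p p' then |φ p| * ((β * (L : ℝ) ^ 2) * ‖propCT L M β μ K p‖) * (|Wd p'| * ((β * (L : ℝ) ^ 2) * ‖propCT L M β μ K p'‖)) else 0) ≤
      C0 * (|φ p| * ‖propCT L M β μ K p‖) := fun p =>
    sum_ite_le_of_card_le_one _ _ _ (by positivity) (fun p' _ _ => weightProd_le_slice hβ μ K hΛ (φ p) p p') (card_partner_le_one Qm x y p)
  have hB' : ∀ p' : FreqMomentum L M,
      (∑ p : FreqMomentum L M, if c p p' then |φ p'| * ((β * (L : ℝ) ^ 2) * ‖propCT L M β μ K p'‖) * (|Wd p| * ((β * (L : ℝ) ^ 2) * ‖propCT L M β μ K p‖)) else 0) ≤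
      C0 * (|φ p'| * ‖propCT L M β μ K p'‖) := fun p' =>
    sum_ite_le_of_card_le_one _ (fun p => c p p') _ (by positivity) (fun p _ _ => weightProd_le_slice hβ μ K hΛ (φ p') p' p) (card_source_le_one Qm x y p')
  calc _ ≤ ∑ p : FreqMomentum L M, ∑ p' : FreqMomentum L M,
        ((if c p p' then |φ p| * ((β * (L : ℝ) ^ 2) * ‖propCT L M β μ K p‖) * (|Wd p'| * ((β * (L : ℝ) ^ 2) * ‖propCT L M β μ K p'‖)) else 0) +
         (if c p p' then |φ p'| * ((β * (L : ℝ) ^ 2) * ‖propCT L M β μ K p'‖) * (|Wd p| * ((β * (L : ℝ) ^ 2) * ‖propCT L M β μ K p‖)) else 0)) :=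
        Finset.sum_le_sum fun p _ => Finset.sum_le_sum fun p' _ => hsplit p p'
    _ = ∑ p : FreqMomentum L M, ∑ p' : FreqMomentum L M,
          (if c p p' then |φ p| * ((β * (L : ℝ) ^ 2) * ‖propCT L M β μ K p‖) * (|Wd p'| * ((β * (L : ℝ) ^ 2) * ‖propCT L M β μ K p'‖)) else 0) +
        ∑ p' : FreqMomentum L M, ∑ p : FreqMomentum L M,
          (if c p p' then |φ p'| * ((β * (L : ℝ) ^ 2) * ‖propCT L M β μ K p'‖) * (|Wd p| * ((β * (L : ℝ) ^ 2) * ‖propCT L M β μ K p‖)) else 0) := by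
        rw [Finset.sum_comm (f := fun p' p => if c p p' then |φ p'| * ((β * (L : ℝ) ^ 2) * ‖propCT L M β μ K p'‖) *
          (|Wd p| * ((β * (L : ℝ) ^ 2) * ‖propCT L M β μ K p‖)) else 0), ← Finset.sum_add_distrib]
        exact Finset.sum_congr rfl fun p _ => Finset.sum_add_distrib
    _ ≤ ∑ p : FreqMomentum L M, C0 * (|φ p| * ‖propCT L M β μ K p‖) + ∑ p' : FreqMomentum L M, C0 * (|φ p'| * ‖propCT L M β μ K p'‖) :=
        add_le_add (Finset.sum_le_sum fun p _ => hA' p) (Finset.sum_le_sum fun p' _ => hB' p')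
    _ = 256 / 3 * (β * (L : ℝ) ^ 2) ^ 2 / Λ ^ 2 * ∑ p : FreqMomentum L M, |φ p| * ‖propCT L M β μ K p‖ := by
        rw [← Finset.mul_sum, hC0]; field_simp; ring

/-- **The BORN mass, flat bound** (any weight `φ`, `0 < Λ`): `Σ_p Σ_σ ‖(ẇ_Λ(p)βĝ(p))(φ(p)βĝ(p))‖ ≤ (256/3)·(βL²)²/Λ²·Σ_p |φ(p)|‖ĝ_K(p)‖`. -/
theorem born_mass_le_softSum [NeZero L] [NeZero M] (hβ : 0 < β) {Λ : ℝ} (hΛ : 0 < Λ) (φ : FreqMomentum L M → ℝ) :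
    ∑ p : FreqMomentum L M, ∑ _σ : Fin 2,
      ‖((((deriv (fun Λ' : ℝ => hubbardCutoffWeightCT L M β μ K Λ' p) Λ : ℝ)) : ℂ) * (((β * (L : ℝ) ^ 2 : ℝ) : ℂ) * propCT L M β μ K p)) *
        (((φ p : ℝ) : ℂ) * (((β * (L : ℝ) ^ 2 : ℝ) : ℂ) * propCT L M β μ K p))‖ ≤
      256 / 3 * (β * (L : ℝ) ^ 2) ^ 2 / Λ ^ 2 * ∑ p : FreqMomentum L M, |φ p| * ‖propCT L M β μ K p‖ := by
  have hT : ∀ p : FreqMomentum L M,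
      ‖((((deriv (fun Λ' : ℝ => hubbardCutoffWeightCT L M β μ K Λ' p) Λ : ℝ)) : ℂ) * (((β * (L : ℝ) ^ 2 : ℝ) : ℂ) * propCT L M β μ K p)) *
        (((φ p : ℝ) : ℂ) * (((β * (L : ℝ) ^ 2 : ℝ) : ℂ) * propCT L M β μ K p))‖ ≤ (β * (L : ℝ) ^ 2) ^ 2 * (128 / (3 * Λ ^ 2)) * (|φ p| * ‖propCT L M β μ K p‖) := by
    intro p
    rw [norm_weightProd_eq hβ]
    calc _ = |φ p| * ((β * (L : ℝ) ^ 2) * ‖propCT L M β μ K p‖) *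
          (|deriv (fun Λ' : ℝ => hubbardCutoffWeightCT L M β μ K Λ' p) Λ| * ((β * (L : ℝ) ^ 2) * ‖propCT L M β μ K p‖)) := by ring
      _ ≤ _ := weightProd_le_slice hβ μ K hΛ (φ p) p p
  calc _ = ∑ p : FreqMomentum L M, 2 * ‖((((deriv (fun Λ' : ℝ => hubbardCutoffWeightCT L M β μ K Λ' p) Λ : ℝ)) : ℂ) * (((β * (L : ℝ) ^ 2 : ℝ) : ℂ) * propCT L M β μ K p)) *
        (((φ p : ℝ) : ℂ) * (((β * (L : ℝ) ^ 2 : ℝ) : ℂ) * propCT L M β μ K p))‖ := by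
        refine Finset.sum_congr rfl fun p _ => ?_
        rw [Finset.sum_const, Finset.card_univ, Fintype.card_fin, nsmul_eq_mul]; norm_num
    _ ≤ ∑ p : FreqMomentum L M, 2 * ((β * (L : ℝ) ^ 2) ^ 2 * (128 / (3 * Λ ^ 2)) * (|φ p| * ‖propCT L M β μ K p‖)) :=
        Finset.sum_le_sum fun p _ => mul_le_mul_of_nonneg_left (hT p) (by norm_num)
    _ = 2 * ((β * (L : ℝ) ^ 2) ^ 2 * (128 / (3 * Λ ^ 2))) * ∑ p : FreqMomentum L M, |φ p| * ‖propCT L M β μ K p‖ := by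
        rw [Finset.mul_sum]; exact Finset.sum_congr rfl fun p _ => by ring
    _ = 256 / 3 * (β * (L : ℝ) ^ 2) ^ 2 / Λ ^ 2 * ∑ p : FreqMomentum L M, |φ p| * ‖propCT L M β μ K p‖ := by
        congr 1; field_simp; ring

/-! ## §3 The flat rows in the door's normalisation (append, g16): `(Λₙ−Λₙ₊₁)·((βL²)³)⁻¹·W ≤ c·klSoftMass n φ` at `Λ = Λ(t)` -/

/-- The common arithmetic: `(Λₙ − Λₙ₊₁)·((βL²)³)⁻¹·(c·(βL²)²/Λ²·(Λₙ·βL²·m)) ≤ 12c·m` once `Λₙ₊₁ = Λₙ/4 ≤ Λ` (`0 ≤ m`, `0 ≤ c`). -/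
theorem flat_row_arith {β L Λ Λn Λn1 c m : ℝ} (hβ : 0 < β) (hL : 0 < L) (hΛ : 0 < Λ) (hΛn : 0 ≤ Λn) (hΛn1 : Λn1 = Λn / 4) (hq : Λn / 4 ≤ Λ)
    (hc : 0 ≤ c) (hm : 0 ≤ m) :
    (Λn - Λn1) * ((β * L ^ 2) ^ 3)⁻¹ * (c * (β * L ^ 2) ^ 2 / Λ ^ 2 * (Λn * (β * L ^ 2) * m)) ≤ 12 * c * m := by
  have e : (Λn - Λn1) * ((β * L ^ 2) ^ 3)⁻¹ * (c * (β * L ^ 2) ^ 2 / Λ ^ 2 * (Λn * (β * L ^ 2) * m)) = 3 / 4 * c * m * (Λn ^ 2 / Λ ^ 2) := by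
    rw [hΛn1]
    field_simp
    ring
  rw [e]
  have h16 : Λn ^ 2 / Λ ^ 2 ≤ 16 := by
    rw [div_le_iff₀ (by positivity)]; nlinarith
  have : 0 ≤ 3 / 4 * c * m := by positivity
  nlinarith

/-- **The DIRECT mass row, flat, in the door's normalisation**: at `Λ = Λ(t)` (`t ∈ [0,1]`), any weight `φ`:
`(Λₙ−Λₙ₊₁)·((βL²)³)⁻¹·Σ_pΣ_σΣ_{p′}𝟙[direct]‖…‖ ≤ 2048·klSoftMass n φ`. -/
theorem direct_row_flat_le [NeZero L] [NeZero M] (hβ : 0 < β) (n : ℕ) {t : ℝ} (ht : t ∈ Icc (0 : ℝ) 1) (φ : FreqMomentum L M → ℝ) (x y : TorusSite 2 L) :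
    (klScale klE0 n - klScale klE0 (n + 1)) * ((β * (L : ℝ) ^ 2) ^ 3)⁻¹ *
      ∑ p : FreqMomentum L M, ∑ _σ : Fin 2, ∑ p' : FreqMomentum L M,
        (if matsubaraInt M p'.1 + matsubaraInt M (omega0 M) = matsubaraInt M p.1 + matsubaraInt M (omega0 M) ∧ p'.2 = p.2 + x - y then
          ‖(((φ p : ℝ) : ℂ) * (((β * (L : ℝ) ^ 2 : ℝ) : ℂ) * propCT L M β μ K p)) *
              ((((deriv (fun Λ' : ℝ => hubbardCutoffWeightCT L M β μ K Λ' p') (klScale klE0 n + t * (klScale klE0 (n + 1) - klScale klE0 n)) : ℝ)) : ℂ) *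
                (((β * (L : ℝ) ^ 2 : ℝ) : ℂ) * propCT L M β μ K p')) +
            ((((deriv (fun Λ' : ℝ => hubbardCutoffWeightCT L M β μ K Λ' p) (klScale klE0 n + t * (klScale klE0 (n + 1) - klScale klE0 n)) : ℝ)) : ℂ) *
                (((β * (L : ℝ) ^ 2 : ℝ) : ℂ) * propCT L M β μ K p)) *
              (((φ p' : ℝ) : ℂ) * (((β * (L : ℝ) ^ 2 : ℝ) : ℂ) * propCT L M β μ K p'))‖
        else 0) ≤ 2048 * klSoftMass L M β μ K n φ := by
  have hL : (0 : ℝ) < L := by exact_mod_cast Nat.pos_of_ne_zero (NeZero.ne L)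
  have hβL : 0 < β * (L : ℝ) ^ 2 := by positivity
  have hΛ := scaleAt_pos n ht
  have h := direct_mass_le_softSum β μ K hβ hΛ φ x y
  rw [softSum_eq_klSoftMass hβ μ K n φ] at h
  have hs := klth_klScale_succ n
  have hq : klScale klE0 n / 4 ≤ klScale klE0 n + t * (klScale klE0 (n + 1) - klScale klE0 n) := by
    have := (scaleAt_mem n ht).1; linarith
  have hpre : 0 ≤ (klScale klE0 n - klScale klE0 (n + 1)) * ((β * (L : ℝ) ^ 2) ^ 3)⁻¹ := by
    have := klth_klScale_pos n
    have : 0 ≤ klScale klE0 n - klScale klE0 (n + 1) := by linarith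
    positivity
  refine (mul_le_mul_of_nonneg_left h hpre).trans ?_
  have := flat_row_arith (c := 512 / 3) hβ hL hΛ (klth_klScale_pos n).le hs hq (by norm_num) (klSoftMass_nonneg β μ K hβ n φ)
  linarith

/-- **The CROSSED mass row, flat, in the door's normalisation**: `≤ 1024·klSoftMass n φ`. -/
theorem crossed_row_flat_le [NeZero L] [NeZero M] (hβ : 0 < β) (n : ℕ) {t : ℝ} (ht : t ∈ Icc (0 : ℝ) 1) (φ : FreqMomentum L M → ℝ) (Qm x y : TorusSite 2 L) :
    (klScale klE0 n - klScale klE0 (n + 1)) * ((β * (L : ℝ) ^ 2) ^ 3)⁻¹ *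
      ∑ p : FreqMomentum L M, ∑ p' : FreqMomentum L M,
        (if matsubaraInt M p'.1 + matsubaraInt M (omega0 M) + matsubaraInt M (omega0 M) + 1 = matsubaraInt M p.1 ∧ p'.2 = p.2 + Qm - x - y then
          ‖(((φ p : ℝ) : ℂ) * (((β * (L : ℝ) ^ 2 : ℝ) : ℂ) * propCT L M β μ K p)) *
              ((((deriv (fun Λ' : ℝ => hubbardCutoffWeightCT L M β μ K Λ' p') (klScale klE0 n + t * (klScale klE0 (n + 1) - klScale klE0 n)) : ℝ)) : ℂ) *
                (((β * (L : ℝ) ^ 2 : ℝ) : ℂ) * propCT L M β μ K p')) +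
            ((((deriv (fun Λ' : ℝ => hubbardCutoffWeightCT L M β μ K Λ' p) (klScale klE0 n + t * (klScale klE0 (n + 1) - klScale klE0 n)) : ℝ)) : ℂ) *
                (((β * (L : ℝ) ^ 2 : ℝ) : ℂ) * propCT L M β μ K p)) *
              (((φ p' : ℝ) : ℂ) * (((β * (L : ℝ) ^ 2 : ℝ) : ℂ) * propCT L M β μ K p'))‖
        else 0) ≤ 1024 * klSoftMass L M β μ K n φ := by
  have hL : (0 : ℝ) < L := by exact_mod_cast Nat.pos_of_ne_zero (NeZero.ne L)
  have hβL : 0 < β * (L : ℝ) ^ 2 := by positivity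
  have hΛ := scaleAt_pos n ht
  have h := crossed_mass_le_softSum β μ K hβ hΛ φ Qm x y
  rw [softSum_eq_klSoftMass hβ μ K n φ] at h
  have hs := klth_klScale_succ n
  have hq : klScale klE0 n / 4 ≤ klScale klE0 n + t * (klScale klE0 (n + 1) - klScale klE0 n) := by
    have := (scaleAt_mem n ht).1; linarith
  have hpre : 0 ≤ (klScale klE0 n - klScale klE0 (n + 1)) * ((β * (L : ℝ) ^ 2) ^ 3)⁻¹ := by
    have := klth_klScale_pos n
    have : 0 ≤ klScale klE0 n - klScale klE0 (n + 1) := by linarith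
    positivity
  refine (mul_le_mul_of_nonneg_left h hpre).trans ?_
  have := flat_row_arith (c := 256 / 3) hβ hL hΛ (klth_klScale_pos n).le hs hq (by norm_num) (klSoftMass_nonneg β μ K hβ n φ)
  linarith

/-- **The BORN mass row, flat, in the door's normalisation**: `≤ 1024·klSoftMass n φ`. -/
theorem born_row_flat_le [NeZero L] [NeZero M] (hβ : 0 < β) (n : ℕ) {t : ℝ} (ht : t ∈ Icc (0 : ℝ) 1) (φ : FreqMomentum L M → ℝ) :
    (klScale klE0 n - klScale klE0 (n + 1)) * ((β * (L : ℝ) ^ 2) ^ 3)⁻¹ *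
      ∑ p : FreqMomentum L M, ∑ _σ : Fin 2,
        ‖((((deriv (fun Λ' : ℝ => hubbardCutoffWeightCT L M β μ K Λ' p) (klScale klE0 n + t * (klScale klE0 (n + 1) - klScale klE0 n)) : ℝ)) : ℂ) *
            (((β * (L : ℝ) ^ 2 : ℝ) : ℂ) * propCT L M β μ K p)) *
          (((φ p : ℝ) : ℂ) * (((β * (L : ℝ) ^ 2 : ℝ) : ℂ) * propCT L M β μ K p))‖ ≤ 1024 * klSoftMass L M β μ K n φ := by
  have hL : (0 : ℝ) < L := by exact_mod_cast Nat.pos_of_ne_zero (NeZero.ne L)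
  have hβL : 0 < β * (L : ℝ) ^ 2 := by positivity
  have hΛ := scaleAt_pos n ht
  have h := born_mass_le_softSum β μ K hβ hΛ φ
  rw [softSum_eq_klSoftMass hβ μ K n φ] at h
  have hs := klth_klScale_succ n
  have hq : klScale klE0 n / 4 ≤ klScale klE0 n + t * (klScale klE0 (n + 1) - klScale klE0 n) := by
    have := (scaleAt_mem n ht).1; linarith
  have hpre : 0 ≤ (klScale klE0 n - klScale klE0 (n + 1)) * ((β * (L : ℝ) ^ 2) ^ 3)⁻¹ := by
    have := klth_klScale_pos n
    have : 0 ≤ klScale klE0 n - klScale klE0 (n + 1) := by linarith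
    positivity
  refine (mul_le_mul_of_nonneg_left h hpre).trans ?_
  have := flat_row_arith (c := 256 / 3) hβ hL hΛ (klth_klScale_pos n).le hs hq (by norm_num) (klSoftMass_nonneg β μ K hβ n φ)
  linarith

end Summit.HubbardSuperconductivity.HubbardSuperconductivity.Theorems.KLRegimeSplit

end
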